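import Mathlib
import Summits.ValiantsHypothesis.ValiantsHypothesis.Theses.LacunarySymmetroid
import Summits.ValiantsHypothesis.ValiantsHypothesis.Theorems.LacunarySymmetroidMatrixDescartesCensusRealExponentsTwoByTwoLocus

/-!
# `MatrixDescartes` census — the CONFLUENT CLOSURE of door A: a log-letter twenty refutes `DoorA26`

HONEST FRAMING.  Object-search cell `pub-symmetroid`, door-A item `Theses.LacunarySymmetroid.DoorA26 = PosRootLawAt 2 6 19`
(stmt-ValiantsHypothesis-19979; OPEN, typed, never asserted).  This file proves ONE elementary implication and decides
nothing: `DoorA26` stays OPEN, no register moves, nothing bears on `MatrixDescartes` (stmt-ValiantsHypothesis-18050) or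
on `VP ≠ VNP`.

The chamber cones of the census line are open towards the faces `d_i = d_j` of the exponent simplex; the natural limit
object of a real symmetric `(2,6)` pencil along such a face is a CONFLUENT pencil with one LOG-LETTER pair,
`F₀(t) = S₀ + e^{a t}(A + t·B) + e^{d₃ t} S₃ + e^{d₄ t} S₄ + e^{d₅ t} S₅` in the variable `t = log x`.
Its determinant lies in a 21-function exponential-polynomial system (Descartes/Laguerre ceiling 20, as for the door).

* `approx_sum_eq` (with `approxLetters_isSymm`) — the honest six-term real-exponent pencils with exponents `(0, a, a + η, d₃, d₄, d₅)` and letters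
  `(S₀, A − η⁻¹B, η⁻¹B, S₃, S₄, S₅)` equal `S₀ + e^{a t}(A + ((e^{η t} − 1)/η)·B) + ⋯`;
* `tendsto_det_approx` — their determinants converge to `det F₀(t)` as `η → 0⁺` (pointwise in `t`);
* **`not_posRootLawAt_2_6_19_of_confluent_brackets`** — if `det F₀` changes sign across twenty pairwise disjoint increasing
  brackets, then `¬ PosRootLawAt 2 6 19`: some honest real-exponent pencil inherits the twenty brackets, hence (tree:
  `Census.RealExp.le_ncard_of_brackets`, `ncard_rpow_eq_ncard_exp`, `not_posRootLawAt_two_iff`) an INTEGER support carries a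
  symmetric `(2,6)` pencil with twenty distinct positive det-roots;
* `not_doorA26_of_confluent_brackets` — the same conclusion as `¬ Theses.LacunarySymmetroid.DoorA26`.

So a refuter who exhibits ONE confluent pencil with 21 certified alternating signs closes the door negatively, and —
contrapositively — every chamber-uniform certificate of the census line must survive the confluent limit on the faces its
cone reaches (the hard chambers 1, 954, 1706, 1709 all reach one).  No such pencil is claimed to exist.

[folklore] Elementary: a difference quotient converging to a derivative, continuity of `det`, the intermediate value theorem
and the tree's real-exponent transfer.
-/

-- `Summit.ValiantsHypothesis.ValiantsHypothesis.…` repeats a component by the D-0017 layout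
-- (single-conjunct summit), which the `dupNamespace` linter flags; the name is mandated.
set_option linter.dupNamespace false

namespace Summit.ValiantsHypothesis.ValiantsHypothesis.Theorems.LacunarySymmetroidMatrixDescartes.Census.RealExp.Confluent

open Filter Topology
open scoped BigOperators Matrix
open Summit.ValiantsHypothesis.ValiantsHypothesis.Theorems.MatrixDescartes.Negative (PosRootLawAt)
open Summit.ValiantsHypothesis.ValiantsHypothesis.Theorems.LacunarySymmetroidMatrixDescartes.Census.RealExp
  (le_ncard_of_brackets ncard_rpow_eq_ncard_exp not_posRootLawAt_two_iff)

/-- The approximants' letters are symmetric when the data are. [folklore] -/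
theorem approxLetters_isSymm {S₀ A B S₃ S₄ S₅ : Matrix (Fin 2) (Fin 2) ℝ} (h₀ : S₀.IsSymm) (hA : A.IsSymm)
    (hB : B.IsSymm) (h₃ : S₃.IsSymm) (h₄ : S₄.IsSymm) (h₅ : S₅.IsSymm) (η : ℝ) (l : Fin 6) :
    (((![S₀, A - η⁻¹ • B, η⁻¹ • B, S₃, S₄, S₅] : Fin 6 → Matrix (Fin 2) (Fin 2) ℝ) l)).IsSymm := by
  fin_cases l
  · simpa using h₀
  · simpa using hA.sub (hB.smul _)
  · simpa using hB.smul _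
  · simpa using h₃
  · simpa using h₄
  · simpa using h₅

/-- **The approximants are honest six-term pencils converging to the confluent one**: for `η ≠ 0`,
`∑_l e^{δ_l t} S'_l = S₀ + e^{a t}(A + ((e^{η t} − 1)/η)·B) + e^{d₃ t} S₃ + e^{d₄ t} S₄ + e^{d₅ t} S₅`. [folklore] -/
theorem approx_sum_eq (a d₃ d₄ d₅ : ℝ) (S₀ A B S₃ S₄ S₅ : Matrix (Fin 2) (Fin 2) ℝ) {η : ℝ} (hη : η ≠ 0) (t : ℝ) :
    ∑ l, Real.exp (((![0, a, a + η, d₃, d₄, d₅] : Fin 6 → ℝ) l) * t) • ((![S₀, A - η⁻¹ • B, η⁻¹ • B, S₃, S₄, S₅] : Fin 6 → Matrix (Fin 2) (Fin 2) ℝ) l) =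
      S₀ + Real.exp (a * t) • (A + ((Real.exp (η * t) - 1) / η) • B) + Real.exp (d₃ * t) • S₃ +
        Real.exp (d₄ * t) • S₄ + Real.exp (d₅ * t) • S₅ := by
  ext i j
  simp [Fin.sum_univ_six, Matrix.sum_apply, Matrix.add_apply, Matrix.smul_apply,
    Matrix.sub_apply, Real.exp_add, add_mul]
  field_simp
  ring

/-- The difference quotient `(e^{η t} − 1)/η → t` as `η → 0⁺`. [folklore] -/
theorem tendsto_expSlope (t : ℝ) :
    Tendsto (fun η : ℝ => (Real.exp (η * t) - 1) / η) (𝓝[>] 0) (𝓝 t) := by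
  have hd : HasDerivAt (fun η : ℝ => Real.exp (η * t)) t 0 := by
    have h := ((hasDerivAt_id (0 : ℝ)).mul_const t).exp
    simpa using h
  have hs := hd.tendsto_slope
  have hs' : Tendsto (slope (fun η : ℝ => Real.exp (η * t)) 0) (𝓝[>] 0) (𝓝 t) :=
    hs.mono_left (nhdsWithin_mono _ (fun x hx => ne_of_gt hx))
  refine hs'.congr' ?_
  filter_upwards [self_mem_nhdsWithin] with η hη
  rw [slope_def_field]
  simp

/-- **Pointwise convergence of the approximants' determinants to the confluent determinant** (`η → 0⁺`). [folklore] -/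
theorem tendsto_det_approx (a d₃ d₄ d₅ : ℝ) (S₀ A B S₃ S₄ S₅ : Matrix (Fin 2) (Fin 2) ℝ) (t : ℝ) :
    Tendsto (fun η : ℝ => (∑ l, Real.exp (((![0, a, a + η, d₃, d₄, d₅] : Fin 6 → ℝ) l) * t) • ((![S₀, A - η⁻¹ • B, η⁻¹ • B, S₃, S₄, S₅] : Fin 6 → Matrix (Fin 2) (Fin 2) ℝ) l)).det)
      (𝓝[>] 0) (𝓝 (S₀ + Real.exp (a * t) • (A + t • B) + Real.exp (d₃ * t) • S₃ + Real.exp (d₄ * t) • S₄ + Real.exp (d₅ * t) • S₅).det) := by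
  have hM : Tendsto (fun η : ℝ => S₀ + Real.exp (a * t) • (A + ((Real.exp (η * t) - 1) / η) • B) +
        Real.exp (d₃ * t) • S₃ + Real.exp (d₄ * t) • S₄ + Real.exp (d₅ * t) • S₅)
      (𝓝[>] 0) (𝓝 (S₀ + Real.exp (a * t) • (A + t • B) + Real.exp (d₃ * t) • S₃ + Real.exp (d₄ * t) • S₄ + Real.exp (d₅ * t) • S₅)) := by
    refine (((tendsto_const_nhds.add ?_).add tendsto_const_nhds).add tendsto_const_nhds).add tendsto_const_nhds
    exact (tendsto_const_nhds.add ((tendsto_expSlope t).smul_const B)).const_smul _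
  have hdet := ((continuous_id.matrix_det).tendsto _).comp hM
  refine hdet.congr' ?_
  filter_upwards [self_mem_nhdsWithin] with η hη
  simp only [Function.comp, id]
  rw [approx_sum_eq a d₃ d₄ d₅ S₀ A B S₃ S₄ S₅ (ne_of_gt hη) t]

/-- **A confluent twenty refutes the (2,6) law**: if the determinant of a confluent pencil with symmetric letters changes sign
across twenty pairwise disjoint increasing brackets `u i < v i` (in `t = log x`), then `¬ PosRootLawAt 2 6 19` — for small
`η > 0` the honest pencil on exponents `(0, a, a + η, d₃, d₄, d₅)` inherits the twenty brackets, has `≥ 20` zeros, and the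
tree's real-exponent transfer (`not_posRootLawAt_two_iff`) produces an integer support. [folklore] -/
theorem not_posRootLawAt_2_6_19_of_confluent_brackets (a d₃ d₄ d₅ : ℝ) {S₀ A B S₃ S₄ S₅ : Matrix (Fin 2) (Fin 2) ℝ}
    (h₀ : S₀.IsSymm) (hA : A.IsSymm) (hB : B.IsSymm) (h₃ : S₃.IsSymm) (h₄ : S₄.IsSymm) (h₅ : S₅.IsSymm)
    (u v : Fin 20 → ℝ) (huv : ∀ i, u i < v i) (hdisj : ∀ i j, i < j → v i < u j)
    (hsign : ∀ i, ((S₀ + Real.exp (a * (u i)) • (A + (u i) • B) + Real.exp (d₃ * (u i)) • S₃ + Real.exp (d₄ * (u i)) • S₄ + Real.exp (d₅ * (u i)) • S₅)).det *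
      ((S₀ + Real.exp (a * (v i)) • (A + (v i) • B) + Real.exp (d₃ * (v i)) • S₃ + Real.exp (d₄ * (v i)) • S₄ + Real.exp (d₅ * (v i)) • S₅)).det < 0) :
    ¬ PosRootLawAt 2 6 19 := by
  -- eventually (η → 0⁺) every bracket is inherited by the honest approximant
  have hev : ∀ᶠ η in 𝓝[>] (0 : ℝ), 0 < η ∧ ∀ i,
      (∑ l, Real.exp (((![0, a, a + η, d₃, d₄, d₅] : Fin 6 → ℝ) l) * u i) • ((![S₀, A - η⁻¹ • B, η⁻¹ • B, S₃, S₄, S₅] : Fin 6 → Matrix (Fin 2) (Fin 2) ℝ) l)).det *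
        (∑ l, Real.exp (((![0, a, a + η, d₃, d₄, d₅] : Fin 6 → ℝ) l) * v i) • ((![S₀, A - η⁻¹ • B, η⁻¹ • B, S₃, S₄, S₅] : Fin 6 → Matrix (Fin 2) (Fin 2) ℝ) l)).det < 0 := by
    refine (self_mem_nhdsWithin : Set.Ioi (0 : ℝ) ∈ 𝓝[>] (0 : ℝ)) |> fun hpos => ?_
    have hall : ∀ᶠ η in 𝓝[>] (0 : ℝ), ∀ i,
        (∑ l, Real.exp (((![0, a, a + η, d₃, d₄, d₅] : Fin 6 → ℝ) l) * u i) • ((![S₀, A - η⁻¹ • B, η⁻¹ • B, S₃, S₄, S₅] : Fin 6 → Matrix (Fin 2) (Fin 2) ℝ) l)).det *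
          (∑ l, Real.exp (((![0, a, a + η, d₃, d₄, d₅] : Fin 6 → ℝ) l) * v i) • ((![S₀, A - η⁻¹ • B, η⁻¹ • B, S₃, S₄, S₅] : Fin 6 → Matrix (Fin 2) (Fin 2) ℝ) l)).det < 0 := by
      refine eventually_all.2 fun i => ?_
      have hprod := (tendsto_det_approx a d₃ d₄ d₅ S₀ A B S₃ S₄ S₅ (u i)).mul
        (tendsto_det_approx a d₃ d₄ d₅ S₀ A B S₃ S₄ S₅ (v i))
      exact hprod.eventually (Iio_mem_nhds (hsign i))
    filter_upwards [hpos, hall] with η hη h using ⟨hη, h⟩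
  obtain ⟨η, hηpos, hη⟩ := hev.exists
  set δ' : Fin 6 → ℝ := (![0, a, a + η, d₃, d₄, d₅] : Fin 6 → ℝ) with hδ'
  set S' : Fin 6 → Matrix (Fin 2) (Fin 2) ℝ := (![S₀, A - η⁻¹ • B, η⁻¹ • B, S₃, S₄, S₅] : Fin 6 → Matrix (Fin 2) (Fin 2) ℝ) with hS'
  have hcount := (le_ncard_of_brackets δ' S' (by norm_num : 0 < 20) huv hdisj hη).2
  rw [← ncard_rpow_eq_ncard_exp δ' S'] at hcount
  exact (not_posRootLawAt_two_iff 6 19).mpr ⟨δ', S', approxLetters_isSymm h₀ hA hB h₃ h₄ h₅ η, hcount⟩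

/-- **Confluent closure of door A**: twenty sign-change brackets of a confluent (log-letter) `(2,6)` pencil determinant refute
`Theses.LacunarySymmetroid.DoorA26` itself (`Theses.LacunarySymmetroid.DoorA26` is `PosRootLawAt 2 6 19` verbatim). No such pencil is
claimed to exist; the door stays OPEN. [folklore] -/
theorem not_doorA26_of_confluent_brackets (a d₃ d₄ d₅ : ℝ) {S₀ A B S₃ S₄ S₅ : Matrix (Fin 2) (Fin 2) ℝ}
    (h₀ : S₀.IsSymm) (hA : A.IsSymm) (hB : B.IsSymm) (h₃ : S₃.IsSymm) (h₄ : S₄.IsSymm) (h₅ : S₅.IsSymm)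
    (u v : Fin 20 → ℝ) (huv : ∀ i, u i < v i) (hdisj : ∀ i j, i < j → v i < u j)
    (hsign : ∀ i, ((S₀ + Real.exp (a * (u i)) • (A + (u i) • B) + Real.exp (d₃ * (u i)) • S₃ + Real.exp (d₄ * (u i)) • S₄ + Real.exp (d₅ * (u i)) • S₅)).det *
      ((S₀ + Real.exp (a * (v i)) • (A + (v i) • B) + Real.exp (d₃ * (v i)) • S₃ + Real.exp (d₄ * (v i)) • S₄ + Real.exp (d₅ * (v i)) • S₅)).det < 0) :
    ¬ Summit.ValiantsHypothesis.ValiantsHypothesis.Theses.LacunarySymmetroid.DoorA26 := by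
  intro hD
  have h := not_posRootLawAt_2_6_19_of_confluent_brackets a d₃ d₄ d₅ h₀ hA hB h₃ h₄ h₅ u v huv hdisj hsign
  exact h fun d S hS => hD d S hS

end Summit.ValiantsHypothesis.ValiantsHypothesis.Theorems.LacunarySymmetroidMatrixDescartes.Census.RealExp.Confluent
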